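import Summits.ValiantsHypothesis.ValiantsHypothesis.Theorems.DefinabilityGapZeroedBlocks
import HarnessLib

/-!
# DefinabilityGap — the SPARSITY rung: every annihilator of the planted KI generator has `≥ ⌊m/2⌋ + 2` monomials

Route `route-ValiantsHypothesis-DefinabilityGap` (decomp-valiant cycle 1, lens 5: hardness–randomness / PIT axis). Census
cells W5 / W19 (the SIZE road of the residual `KIPlantedHitting` = stmt-ValiantsHypothesis-23547, tag IDEA-NEEDED) and
F4 / W10 (`KIPlantedHittingRO`, stmt-ValiantsHypothesis-23704): the first hitting statement for `G_m : y ↦ (per_m(y|S_c))_c`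
whose hypothesis is a SIZE measure — the number of monomials — with no cap on degree or support, and a bound GROWING with `m`.

* MAIN THEOREM `kiPer_hits_of_card_support_le` (`m ≥ 3`): `G_m` hits every nonzero `D ∈ ℂ[z_c : c ∈ 𝔽_q³]` with at most
  `⌊m/2⌋ + 1` monomials (any degree, any supports); equivalently (`card_support_annihilator`) **every annihilator of `G_m`
  has at least `⌊m/2⌋ + 2` monomials** (the two-term rung `DefinabilityGapTwoTermRung` is the case `m = 3`).
* THE ZERO-OUT INDUCTION `kiPerZ_hits_sparse`: the statement is proved for the DEGRADED generators
  `Q^F = (zeroOut F (P_c))_c` (`DefinabilityGapZeroedBlocks`) under the budget "every block read by `D` has seen at most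
  `m − 2 − 2(s − 2)` zeros", `s = #monomials`, by induction on `s`: divide `D` by the largest power of a variable `z_c`
  along which two monomials differ (`eq_monomial_mul_divMonomial`; `Q^F_c ≠ 0` cancels), then substitute `0` for ALL
  cells of block `c`: the monomials still containing `z_c` die (`Q^{F ∪ cells c}_c = 0`), at least one and NOT all
  monomials survive, and every other block acquires `≤ 2` new zeros (quadratic curves meet in `≤ 2` points,
  `card_patOf_union_cells_le`) — a relation with fewer terms for a generator still inside the budget. The base `s ≤ 2` is
  unique factorisation: zeroed block permanents with `≤ m − 2` zeros are pairwise non-associated PRIMES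
  (`perPat_irreducible`, von zur Gathen's argument with avoiding permutations; `kiPerZ_two_term`).

Placement / honest ceiling. Orthogonal to the degree road (which needs SOME monomial on `< ½m² ln m` blocks) and to the
two-term rung; the budget `2(s − 2) ≤ m − 2` is the method's ceiling (zeros accumulate two per killed block), far below the
`q^{Θ(b)}`-sparsity that clause-2 circuits of size `q^b` may have — a RUNG of the size road, not the road. 0 sorry.
-/

noncomputable section

open MvPolynomial
open Literature.Computability.AlgebraicComplexity Literature.Computability.MetaComplexity

namespace Summit.ValiantsHypothesis.ValiantsHypothesis.Theorems.DefinabilityGapSparsityRung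

open Summit.ValiantsHypothesis.ValiantsHypothesis.Theorems.DefinabilityGapAffineRung
open Summit.ValiantsHypothesis.ValiantsHypothesis.Theorems.DefinabilityGapPatternPermanent
open Summit.ValiantsHypothesis.ValiantsHypothesis.Theorems.DefinabilityGapZeroedBlocks

/-! ## 1. Splitting a polynomial along a predicate on exponents; dividing by a monomial -/

section Split

variable {σ : Type*} {R : Type*} [CommSemiring R]

/-- The part of `D` carried by the exponents satisfying `p`. [this file] -/
def part (D : MvPolynomial σ R) (p : (σ →₀ ℕ) → Prop) [DecidablePred p] : MvPolynomial σ R :=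
  ∑ κ ∈ D.support.filter p, monomial κ (coeff κ D)

/-- Coefficients of the `p`-part. [this file] -/
theorem coeff_part (D : MvPolynomial σ R) (p : (σ →₀ ℕ) → Prop) [DecidablePred p] (κ : σ →₀ ℕ) :
    coeff κ (part D p) = if p κ then coeff κ D else 0 := by
  classical
  rw [part, coeff_sum]
  simp_rw [coeff_monomial]
  rw [Finset.sum_ite_eq']
  simp only [Finset.mem_filter, mem_support_iff]
  by_cases hp : p κ
  · by_cases h0 : coeff κ D = 0
    · simp [hp, h0]
    · simp [hp, h0]
  · simp [hp]

/-- Support of the `p`-part. [this file] -/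
theorem support_part (D : MvPolynomial σ R) (p : (σ →₀ ℕ) → Prop) [DecidablePred p] :
    (part D p).support = D.support.filter p := by
  ext κ
  rw [mem_support_iff, coeff_part, Finset.mem_filter, mem_support_iff]
  by_cases hp : p κ <;> simp [hp]

/-- `D` is the sum of its `p`-part and its `¬p`-part. [this file] -/
theorem part_add_part_not (D : MvPolynomial σ R) (p : (σ →₀ ℕ) → Prop) [DecidablePred p] :
    part D p + part D (fun κ => ¬ p κ) = D := by
  rw [part, part, Finset.sum_filter_add_sum_filter_not, ← D.as_sum]

/-- If every exponent of `D` dominates `e`, then `D = z^e · (D / z^e)`. [folklore] -/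
theorem eq_monomial_mul_divMonomial (D : MvPolynomial σ R) (e : σ →₀ ℕ) (h : ∀ κ ∈ D.support, e ≤ κ) :
    D = monomial e 1 * MvPolynomial.divMonomial D e := by
  classical
  have hmod : MvPolynomial.modMonomial D e = 0 := by
    ext κ
    rw [coeff_zero]
    by_cases hle : e ≤ κ
    · exact coeff_modMonomial_of_le D hle
    · rw [coeff_modMonomial_of_not_le D hle]
      exact notMem_support_iff.1 fun hκ => hle (h κ hκ)
  conv_lhs => rw [← MvPolynomial.divMonomial_add_modMonomial D e, hmod, add_zero]

/-- Dividing by a monomial does not increase the number of terms. [folklore] -/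
theorem card_support_divMonomial_le (D : MvPolynomial σ R) (e : σ →₀ ℕ) :
    (MvPolynomial.divMonomial D e).support.card ≤ D.support.card := by
  classical
  refine Finset.card_le_card_of_injOn (fun κ => e + κ) (fun κ hκ => ?_) (add_right_injective e).injOn
  have hκ' : coeff κ (MvPolynomial.divMonomial D e) ≠ 0 := mem_support_iff.1 hκ
  rw [coeff_divMonomial] at hκ'
  exact mem_support_iff.2 hκ'

end Split

/-! ## 2. The zero-out induction -/

variable {m : ℕ}

/-- **The zero-out induction.** For `m ≥ 3`, a zero set `F ⊆ 𝔽_q²` and `D` with `s` monomials such that every block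
read by `D` has seen at most `m − 2 − 2(s − 2)` zeros: `D(Q^F) = 0 ⇒ D = 0`. [this file] -/
theorem kiPerZ_hits_sparse (hm : 3 ≤ m) :
    ∀ (s : ℕ) (F : Finset (Fin (qOf m) × Fin (qOf m))) (D : MvPolynomial (Fin 3 → Fin (qOf m)) ℂ),
      D.support.card = s →
      (∀ κ ∈ D.support, ∀ c ∈ κ.support, (patOf m F c).card + 2 * (s - 2) + 2 ≤ m) →
      bind₁ (kiPerZ m F) D = 0 → D = 0 := by
  classical
  intro s
  refine Nat.strong_induction_on s ?_
  intro s ih F D hs hbudget h0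
  rcases Nat.lt_or_ge s 3 with hs3 | hs3
  · interval_cases s
    · exact MvPolynomial.support_eq_empty.1 (Finset.card_eq_zero.1 hs)
    · -- one monomial: a product of non-zero primes
      exfalso
      obtain ⟨κ, hκ⟩ := Finset.card_eq_one.1 hs
      have hκm : κ ∈ D.support := hκ ▸ Finset.mem_singleton_self κ
      have hD : D = monomial κ (coeff κ D) := by
        conv_lhs => rw [D.as_sum, hκ, Finset.sum_singleton]
      rw [hD, bind₁_monomial] at h0
      rcases mul_eq_zero.1 h0 with h1 | h1
      · exact mem_support_iff.1 hκm ((C_eq_zero).1 h1)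
      · exact prod_kiPerZ_pow_ne_zero κ (fun c hc => by have := hbudget κ hκm c hc; omega) h1
    · -- two monomials: unique factorisation
      exfalso
      obtain ⟨κ, κ', hne, hκκ'⟩ := Finset.card_eq_two.1 hs
      have hκm : κ ∈ D.support := hκκ' ▸ Finset.mem_insert_self _ _
      have hκ'm : κ' ∈ D.support := hκκ' ▸ Finset.mem_insert_of_mem (Finset.mem_singleton_self _)
      have hD : D = monomial κ (coeff κ D) + monomial κ' (coeff κ' D) := by
        conv_lhs => rw [D.as_sum, hκκ', Finset.sum_pair hne]
      rw [hD] at h0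
      have key := kiPerZ_two_term hm hne (fun c hc => by have := hbudget κ hκm c hc; omega)
        (fun c hc => by have := hbudget κ' hκ'm c hc; omega) h0
      exact mem_support_iff.1 hκm key.1
  · -- at least three monomials: zero out one block
    exfalso
    obtain ⟨κ₁, hκ₁, κ₂, hκ₂, hne⟩ := Finset.one_lt_card.1 (by omega : 1 < D.support.card)
    obtain ⟨c, hc⟩ := DFunLike.ne_iff.1 hne
    have hDne : D.support.Nonempty := ⟨κ₁, hκ₁⟩
    -- the least exponent of `z_c` among the monomials, and a monomial with a larger one
    set n₀ := D.support.inf' hDne (fun κ => κ c) with hn₀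
    have hn₀le : ∀ κ ∈ D.support, n₀ ≤ κ c := fun κ hκ => Finset.inf'_le _ hκ
    obtain ⟨κm, hκm, hκmc⟩ := Finset.exists_mem_eq_inf' hDne (fun κ => κ c)
    obtain ⟨κM, hκM, hκMc⟩ : ∃ κM ∈ D.support, n₀ < κM c := by
      rcases Nat.lt_or_gt_of_ne hc with hlt | hlt
      · exact ⟨κ₂, hκ₂, (hn₀le κ₁ hκ₁).trans_lt hlt⟩
      · exact ⟨κ₁, hκ₁, (hn₀le κ₂ hκ₂).trans_lt hlt⟩
    have hcM : c ∈ κM.support := Finsupp.mem_support_iff.2 (by omega)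
    have hcsmall : (patOf m F c).card + 2 ≤ m := by have := hbudget κM hκM c hcM; omega
    -- divide by `z_c^{n₀}`
    set e : (Fin 3 → Fin (qOf m)) →₀ ℕ := Finsupp.single c n₀ with he
    have hle : ∀ κ ∈ D.support, e ≤ κ := fun κ hκ => Finsupp.single_le_iff.2 (hn₀le κ hκ)
    set D' := MvPolynomial.divMonomial D e with hD'
    have hDe : D = monomial e 1 * D' := eq_monomial_mul_divMonomial D e hle
    have hmemD' : ∀ κ, κ ∈ D'.support ↔ e + κ ∈ D.support := fun κ => by
      rw [mem_support_iff, mem_support_iff, hD', coeff_divMonomial]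
    have h0' : bind₁ (kiPerZ m F) D' = 0 := by
      rw [hDe, map_mul, bind₁_monomial, C_1, one_mul] at h0
      rcases mul_eq_zero.1 h0 with h1 | h1
      · exfalso
        refine prod_kiPerZ_pow_ne_zero e (fun i hi => ?_) h1
        rw [he, Finsupp.mem_support_iff, Finsupp.single_apply] at hi
        split_ifs at hi with hic
        · subst hic; exact hcsmall
        · exact absurd rfl hi
      · exact h1
    -- zero out the cells of `c`
    set F' := F ∪ cells m c with hF'
    have h0'' : bind₁ (kiPerZ m F') D' = 0 := by
      have := congrArg (zeroOut m (cells m c)) h0'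
      rw [map_zero, zeroOut_bind₁] at this
      simp_rw [zeroOut_kiPerZ] at this
      exact this
    -- the monomials still containing `z_c` die; the others form `D₀`
    set D₀ := part D' (fun κ => κ c = 0) with hD₀
    have hkill : bind₁ (kiPerZ m F') (part D' fun κ => ¬ κ c = 0) = 0 := by
      rw [part, map_sum]
      refine Finset.sum_eq_zero fun κ hκ => ?_
      rw [Finset.mem_filter] at hκ
      rw [bind₁_monomial]
      refine mul_eq_zero_of_right _ (Finset.prod_eq_zero (Finsupp.mem_support_iff.2 hκ.2) ?_)
      rw [kiPerZ_eq_zero (by omega) (by rw [hF']; exact Finset.subset_union_right), zero_pow hκ.2]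
    have h0₀ : bind₁ (kiPerZ m F') D₀ = 0 := by
      have := h0''
      rw [← part_add_part_not D' (fun κ => κ c = 0), map_add, hkill, add_zero] at this
      exact this
    have hsuppD₀ : D₀.support = D'.support.filter (fun κ => κ c = 0) := support_part D' _
    -- `κm − e` survives, `κM − e` does not
    have hκm' : κm - e ∈ D₀.support := by
      rw [hsuppD₀, Finset.mem_filter, hmemD', add_tsub_cancel_of_le (hle κm hκm)]
      refine ⟨hκm, ?_⟩
      rw [Finsupp.tsub_apply, he, Finsupp.single_eq_same]
      omega
    have hκM' : κM - e ∈ D'.support := by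
      rw [hmemD', add_tsub_cancel_of_le (hle κM hκM)]; exact hκM
    have hcard₀ : D₀.support.card + 1 ≤ s := by
      have hss : D₀.support ⊂ D'.support := by
        rw [hsuppD₀]
        refine Finset.filter_ssubset.2 ⟨κM - e, hκM', ?_⟩
        rw [Finsupp.tsub_apply, he, Finsupp.single_eq_same]
        omega
      have h1 := Finset.card_lt_card hss
      have h2 : D'.support.card ≤ s := hs ▸ card_support_divMonomial_le D e
      omega
    -- the budget of the surviving relation
    have hbudget₀ : ∀ κ ∈ D₀.support, ∀ i ∈ κ.support,
        (patOf m F' i).card + 2 * (D₀.support.card - 2) + 2 ≤ m := by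
      intro κ hκ i hi
      rw [hsuppD₀, Finset.mem_filter, hmemD'] at hκ
      have hic : i ≠ c := fun h => by
        rw [h] at hi
        exact (Finsupp.mem_support_iff.1 hi) hκ.2
      have hi' : i ∈ (e + κ).support := by
        rw [Finsupp.mem_support_iff, Finsupp.add_apply]
        have := Finsupp.mem_support_iff.1 hi
        omega
      have hb := hbudget (e + κ) hκ.1 i hi'
      have hacc : (patOf m F' i).card ≤ (patOf m F i).card + 2 := by
        rw [hF']; exact card_patOf_union_cells_le hic F
      omega
    -- induction
    have key := ih D₀.support.card (by omega) F' D₀ rfl hbudget₀ h0₀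
    rw [key, support_zero] at hκm'
    exact Finset.notMem_empty _ hκm'

/-! ## 3. The sparsity rung for `G_m` -/

/-- **SPARSITY RUNG.** For `m ≥ 3`, `G_m` hits every nonzero `D` with at most `⌊m/2⌋ + 1` monomials
(`2·#monomials ≤ m + 2`) — no assumption on degree or supports. [this file] -/
theorem kiPer_hits_of_card_support_le (hm : 3 ≤ m) {D : MvPolynomial (Fin 3 → Fin (qOf m)) ℂ} (hD : D ≠ 0)
    (hs : 2 * D.support.card ≤ m + 2) : bind₁ (kiPer m) D ≠ 0 := by
  intro h0
  apply hD
  refine kiPerZ_hits_sparse hm D.support.card ∅ D rfl (fun κ _ c _ => ?_) ?_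
  · rw [patOf_empty, Finset.card_empty]
    omega
  · have : kiPerZ m ∅ = kiPer m := funext kiPerZ_empty
    rw [this]
    exact h0

/-- **Every annihilator of `G_m` has at least `⌊m/2⌋ + 2` monomials** (`m ≥ 3`). [this file] -/
theorem card_support_annihilator (hm : 3 ≤ m) {D : MvPolynomial (Fin 3 → Fin (qOf m)) ℂ} (hD : D ≠ 0)
    (h0 : bind₁ (kiPer m) D = 0) : m / 2 + 2 ≤ D.support.card := by
  by_contra hlt
  exact kiPer_hits_of_card_support_le hm hD (by omega) h0

end Summit.ValiantsHypothesis.ValiantsHypothesis.Theorems.DefinabilityGapSparsityRung
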